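/-
Copyright: the b2b-balaban T⁴-continuum CRUX team, row NE7b OWNER lineage `t4-ne7b-p1` (gen 142). Project licence.
-/
import Summits.QuantumFields.BalabanUV.T4Continuum.Spine.NE7b.SupGroupCovarianceFive

/-!
# THE TWO GENERIC CUT BOUNDS OF THE FIFTH CUMULANT WITH INTEGER POWERS (SCOPING (d14)(2)(ii), fifth analytic order-five file — the order-5
# analogue of (491)).  Same abstract Gibbs format; five class observables whose Dobrushin bilinear forms DECAY, `B(a_i,a_j) ≤ K∕r_{ij}²⁴` for pair
# weights `r_{ij} ≥ 1` ((466) in the whitened setting), centred moments `≤ M₂, M₄, M₆`.  Choosing the truncation level `R = r_min⁶`, `r_min` the least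
# weight crossing the cut, in (544) (`R³·nK∕r_min²⁴ = nK∕r_min⁶` — the SAME sixth root as at order four):
#   single cut       `|E[f₁f₂f₃f₄f₅]| ≤ (4K + 5M₆ + M₂M₄)∕min(r₁₂,r₁₃,r₁₄,r₁₅)⁶`,
#   pair–triple cut  `|E[f₁⋯f₅] − E[f₁f₂]E[f₃f₄f₅]| ≤ (6K + 5M₆ + (M₂+M₄)²∕2 + 3M₂M₄)∕min(r₁₃,r₁₄,r₁₅,r₂₃,r₂₄,r₂₅)⁶`
# — by relabelling these two generic bounds give all FIFTEEN cuts of (539)∕(537) once (540)'s algebra has isolated the straddling terms (row NE7b,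
# node U5c; (544) `group_cov_one_four_le`, `group_cov_two_three_le` BY NAME; [folklore])

Cell `pub-balaban`, sub-cell `t4`, spine estimate NE7b (`T4WeightBudget.RelWeightBound`; the cell's OWN estimate — NOT PRINTED in
[Bałaban 1983–89], NOT PROVED).  Crux-route work under `Spine/NE7b/` by the row OWNER (`t4-ne7b-p1` gen 142, file (545)) under FREEZE
(0)'s crux-prover clause; NOTHING of Bałaban's is named as a Lean object, valued or asserted; no `T4Continuum/Support` leaf typed; no
`def`, no notation; zero `sorry`.  Imports (BY NAME): the OWNER's (544) `…SupGroupCovarianceFive`.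

WHAT IS PROVED ([folklore]): §1 `trunc_cube_decay_eq` (`(r⁶)³·(nK∕r²⁴) = nK∕r⁶`); §2 **`single_cut_bound5`**, **`pair_triple_cut_bound`**; §3 toy.

HONEST (what this is NOT).  Two generic cut bounds; the fifteen instantiations with (540)'s straddling products (the pair moments `|E f_if_j| ≤ K∕r²⁴`
by (491) `pairing_abs_le`, the triple moments by (461)∕(463)'s third-cumulant tree), the assembly `|u₅| ≤ C·t⋆⁴` by (539), the whitened
instantiation (`F_v = U′(Aξ+ψ)[e_v]`, (466)'s decay, (505)'s sixth moment) and the kernel letter by (538) are the successor's; the cumulant FORM of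
`∂⁵W` is NOT typed; scalar skeleton ((A3), NC-NE7b-α UNRULED); nothing of Bałaban's asserted.  BY-NAME EFFECT ON THE WALL: NONE.  NE7b NOT PRINTED
∕ NOT PROVED; spine PROVED 0∕9; rung (B)+1 — FINITE-torus statements; NOT the mass gap, NOT Clay.  HONEST DEPENDENCY: continuum YM on T⁴ ⇐
BetaPertH ∧ nine spine estimates (0∕9 proved); BetaPertH ⇐ (D1) ∧ (D4) ∧ CAP+tail; G-an2-4 gates asym, D1 and NE2∕3∕4.
-/

set_option autoImplicit false

noncomputable section

namespace Summit.QuantumFields.BalabanUV.T4Continuum.NE7b.SupFifthCumulantCutBounds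

open MeasureTheory Real Set Function Finset
open scoped BigOperators
open SupGroupCovarianceFive (group_cov_one_four_le group_cov_two_three_le)

/-! ## §1. Power bookkeeping -/

/-- **Power bookkeeping at order five**: `(r⁶)³·(nK∕r²⁴) = nK∕r⁶` for `r > 0`. [folklore] -/
theorem trunc_cube_decay_eq (nK : ℝ) {rm : ℝ} (hrm : 0 < rm) : (rm ^ 6) ^ 3 * (nK / rm ^ 24) = nK / rm ^ 6 := by
  rw [eq_div_iff (by positivity), div_eq_mul_inv]
  have h24 : (rm ^ 24)⁻¹ * rm ^ 24 = 1 := inv_mul_cancel₀ (by positivity)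
  calc (rm ^ 6) ^ 3 * (nK * (rm ^ 24)⁻¹) * rm ^ 6 = nK * ((rm ^ 24)⁻¹ * rm ^ 24) := by ring
    _ = nK := by rw [h24, mul_one]

/-! ## §2. The two generic cut bounds -/

variable {ι : Type} [Fintype ι] [DecidableEq ι]

variable {V : (ι → ℝ) → ℝ} {V₁ : ι → (ι → ℝ) → ℝ} {c : ι → ℝ} {Cw γ : ℝ} {J D : ι → ι → ℝ}
  {P : ι → ((ι → ℝ) → ℝ) → ((ι → ℝ) → ℝ)} {F₁ F₂ F₃ F₄ F₅ : (ι → ℝ) → ℝ} {a₁ a₂ a₃ a₄ a₅ : ι → ℝ}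

/-- **THE SINGLE CUT `{1}|{2,3,4,5}`**: with `R = min(r₁₂,r₁₃,r₁₄,r₁₅)⁶` in (544), `|E[f₁f₂f₃f₄f₅]| ≤ (4K + 5M₆ + M₂M₄)∕min(r₁₂,r₁₃,r₁₄,r₁₅)⁶`
(`f₁` centred at its mean, the others at arbitrary constants). [folklore] -/
theorem single_cut_bound5
    (hP : ∀ x F ω, P x F ω = (∫ s, F (update ω x s) * exp (-V (update ω x s))) / ∫ s, exp (-V (update ω x s)))
    (hV : ∀ x ω, HasDerivAt (fun s => V (update ω x s)) (V₁ x ω) (ω x))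
    (hfloor : ∀ x ω s t, c x * (s - t) ^ 2 ≤ (V₁ x (update ω x s) - V₁ x (update ω x t)) * (s - t)) (hc : ∀ x, 0 < c x)
    (hceil : ∀ x ω s t, |V₁ x (update ω x s) - V₁ x (update ω x t)| ≤ Cw * |s - t|)
    (hcross : ∀ x z, z ≠ x → ∀ ω s t, |V₁ x (update ω z s) - V₁ x (update ω z t)| ≤ J x z * |s - t|) (hVc : Continuous V)
    (hV0 : Integrable (fun ω : ι → ℝ => exp (-V ω))) (hV2 : ∀ z, Integrable (fun ω : ι → ℝ => ω z ^ 2 * exp (-V ω)))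
    (hJ : ∀ x z, 0 ≤ J x z) (hJ0 : ∀ x, J x x = 0) (hrow : ∀ x, ∑ z, J x z / c x ≤ γ) (hγ0 : 0 ≤ γ) (hγ1 : γ < 1)
    (hD : ∀ x y, 0 ≤ D x y) (hDC : ∀ x y, (if x = y then (1 : ℝ) else 0) + ∑ z, D x z * (J z y / c z) ≤ D x y)
    (h1 : ∀ z ω s t, |F₁ (update ω z s) - F₁ (update ω z t)| ≤ a₁ z * |s - t|)
    (h2 : ∀ z ω s t, |F₂ (update ω z s) - F₂ (update ω z t)| ≤ a₂ z * |s - t|)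
    (h3 : ∀ z ω s t, |F₃ (update ω z s) - F₃ (update ω z t)| ≤ a₃ z * |s - t|)
    (h4 : ∀ z ω s t, |F₄ (update ω z s) - F₄ (update ω z t)| ≤ a₄ z * |s - t|)
    (h5 : ∀ z ω s t, |F₅ (update ω z s) - F₅ (update ω z t)| ≤ a₅ z * |s - t|) (m₂ m₃ m₄ m₅ : ℝ)
    {K r12 r13 r14 r15 M₂ M₄ M₆ : ℝ} (hK : 0 ≤ K) (hr12 : 1 ≤ r12) (hr13 : 1 ≤ r13) (hr14 : 1 ≤ r14) (hr15 : 1 ≤ r15)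
    (hB12 : (∑ w, (∑ z, D z w * a₁ z) * (∑ z, D z w * a₂ z) / c w) ≤ K / r12 ^ 24) (hB13 : (∑ w, (∑ z, D z w * a₁ z) * (∑ z, D z w * a₃ z) / c w) ≤ K
        / r13 ^ 24) (hB14 : (∑ w, (∑ z, D z w * a₁ z) * (∑ z, D z w * a₄ z) / c w) ≤ K / r14 ^ 24) (hB15 : (∑ w, (∑ z, D z w * a₁ z) * (∑ z, D z w *
        a₅ z) / c w) ≤ K / r15 ^ 24)
    (hq1 : Integrable (fun ω => (F₁ ω - (∫ ω', F₁ ω' ∂((volume : Measure (ι → ℝ)).tilted fun ω => -V ω))) ^ 4) ((volume : Measure (ι → ℝ)).tilted fun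
        ω => -V ω))
    (hq2 : Integrable (fun ω => (F₂ ω - m₂) ^ 4) ((volume : Measure (ι → ℝ)).tilted fun ω => -V ω))
    (hq3 : Integrable (fun ω => (F₃ ω - m₃) ^ 4) ((volume : Measure (ι → ℝ)).tilted fun ω => -V ω))
    (hq4 : Integrable (fun ω => (F₄ ω - m₄) ^ 4) ((volume : Measure (ι → ℝ)).tilted fun ω => -V ω))
    (hq5 : Integrable (fun ω => (F₅ ω - m₅) ^ 4) ((volume : Measure (ι → ℝ)).tilted fun ω => -V ω))
    (hs1 : Integrable (fun ω => (F₁ ω - (∫ ω', F₁ ω' ∂((volume : Measure (ι → ℝ)).tilted fun ω => -V ω))) ^ 6) ((volume : Measure (ι → ℝ)).tilted fun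
        ω => -V ω))
    (hs2 : Integrable (fun ω => (F₂ ω - m₂) ^ 6) ((volume : Measure (ι → ℝ)).tilted fun ω => -V ω))
    (hs3 : Integrable (fun ω => (F₃ ω - m₃) ^ 6) ((volume : Measure (ι → ℝ)).tilted fun ω => -V ω))
    (hs4 : Integrable (fun ω => (F₄ ω - m₄) ^ 6) ((volume : Measure (ι → ℝ)).tilted fun ω => -V ω))
    (hs5 : Integrable (fun ω => (F₅ ω - m₅) ^ 6) ((volume : Measure (ι → ℝ)).tilted fun ω => -V ω))
    (hM21 : ∫ ω, (F₁ ω - (∫ ω', F₁ ω' ∂((volume : Measure (ι → ℝ)).tilted fun ω => -V ω))) ^ 2 ∂((volume : Measure (ι → ℝ)).tilted fun ω => -V ω) ≤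
        M₂)
    (hM42 : ∫ ω, (F₂ ω - m₂) ^ 4 ∂((volume : Measure (ι → ℝ)).tilted fun ω => -V ω) ≤ M₄)
    (hM43 : ∫ ω, (F₃ ω - m₃) ^ 4 ∂((volume : Measure (ι → ℝ)).tilted fun ω => -V ω) ≤ M₄)
    (hM44 : ∫ ω, (F₄ ω - m₄) ^ 4 ∂((volume : Measure (ι → ℝ)).tilted fun ω => -V ω) ≤ M₄)
    (hM45 : ∫ ω, (F₅ ω - m₅) ^ 4 ∂((volume : Measure (ι → ℝ)).tilted fun ω => -V ω) ≤ M₄)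
    (hM61 : ∫ ω, (F₁ ω - (∫ ω', F₁ ω' ∂((volume : Measure (ι → ℝ)).tilted fun ω => -V ω))) ^ 6 ∂((volume : Measure (ι → ℝ)).tilted fun ω => -V ω) ≤
        M₆)
    (hM62 : ∫ ω, (F₂ ω - m₂) ^ 6 ∂((volume : Measure (ι → ℝ)).tilted fun ω => -V ω) ≤ M₆)
    (hM63 : ∫ ω, (F₃ ω - m₃) ^ 6 ∂((volume : Measure (ι → ℝ)).tilted fun ω => -V ω) ≤ M₆)
    (hM64 : ∫ ω, (F₄ ω - m₄) ^ 6 ∂((volume : Measure (ι → ℝ)).tilted fun ω => -V ω) ≤ M₆)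
    (hM65 : ∫ ω, (F₅ ω - m₅) ^ 6 ∂((volume : Measure (ι → ℝ)).tilted fun ω => -V ω) ≤ M₆) :
    |∫ ω, (F₁ ω - (∫ ω', F₁ ω' ∂((volume : Measure (ι → ℝ)).tilted fun ω => -V ω))) * (F₂ ω - m₂) * (F₃ ω - m₃) * (F₄ ω - m₄) * (F₅ ω - m₅) ∂((volume
        : Measure (ι → ℝ)).tilted fun ω => -V ω)| ≤
      (4 * K + 5 * M₆ + M₂ * M₄) / (min r12 (min r13 (min r14 r15))) ^ 6 := by
  set rm : ℝ := min r12 (min r13 (min r14 r15)) with hrm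
  have hrm1 : 1 ≤ rm := le_min hr12 (le_min hr13 (le_min hr14 (hr15)))
  have hrm0 : 0 < rm := by linarith
  have l12 : rm ≤ r12 := min_le_left _ _
  have l13 : rm ≤ r13 := (min_le_right _ _).trans (min_le_left _ _)
  have l14 : rm ≤ r14 := (min_le_right _ _).trans ((min_le_right _ _).trans (min_le_left _ _))
  have l15 : rm ≤ r15 := (min_le_right _ _).trans ((min_le_right _ _).trans (min_le_right _ _))
  have hR : 0 < rm ^ 6 := by positivity
  have h := group_cov_one_four_le hP hV hfloor hc hceil hcross hVc hV0 hV2 hJ hJ0 hrow hγ0 hγ1 hD hDC h1 h2 h3 h4 h5 m₂ m₃ m₄ m₅ hR hq1 hq2 hq3 hq4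
      hq5 hs1 hs2 hs3 hs4 hs5 hM21 hM42 hM43 hM44 hM45 hM61 hM62 hM63 hM64 hM65
  -- the bilinear form across the cut is the sum of the four crossing forms
  have hsplit : ∑ w, (∑ z, D z w * a₁ z) * ((∑ z, D z w * a₂ z) + (∑ z, D z w * a₃ z) + (∑ z, D z w * a₄ z) + ∑ z, D z w * a₅ z) / c w =
      (∑ w, (∑ z, D z w * a₁ z) * (∑ z, D z w * a₂ z) / c w) + (∑ w, (∑ z, D z w * a₁ z) * (∑ z, D z w * a₃ z) / c w) + (∑ w, (∑ z, D z w * a₁ z) *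
          (∑ z, D z w * a₄ z) / c w) + (∑ w, (∑ z, D z w * a₁ z) * (∑ z, D z w * a₅ z) / c w) := by
    rw [← Finset.sum_add_distrib, ← Finset.sum_add_distrib, ← Finset.sum_add_distrib]
    exact Finset.sum_congr rfl fun w _ => by ring
  have hB : ∑ w, (∑ z, D z w * a₁ z) * ((∑ z, D z w * a₂ z) + (∑ z, D z w * a₃ z) + (∑ z, D z w * a₄ z) + ∑ z, D z w * a₅ z) / c w ≤ 4 * K / rm ^ 24
      := by
    rw [hsplit]
    have e12 := div_le_div_of_nonneg_left hK (by positivity : (0 : ℝ) < rm ^ 24) (pow_le_pow_left₀ hrm0.le l12 24)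
    have e13 := div_le_div_of_nonneg_left hK (by positivity : (0 : ℝ) < rm ^ 24) (pow_le_pow_left₀ hrm0.le l13 24)
    have e14 := div_le_div_of_nonneg_left hK (by positivity : (0 : ℝ) < rm ^ 24) (pow_le_pow_left₀ hrm0.le l14 24)
    have e15 := div_le_div_of_nonneg_left hK (by positivity : (0 : ℝ) < rm ^ 24) (pow_le_pow_left₀ hrm0.le l15 24)
    have e4 : 4 * K / rm ^ 24 = K / rm ^ 24 + K / rm ^ 24 + K / rm ^ 24 + K / rm ^ 24 := by ring
    rw [e4]
    linarith [hB12.trans e12, hB13.trans e13, hB14.trans e14, hB15.trans e15]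
  have hT : (rm ^ 6) ^ 3 * (∑ w, (∑ z, D z w * a₁ z) * ((∑ z, D z w * a₂ z) + (∑ z, D z w * a₃ z) + (∑ z, D z w * a₄ z) + ∑ z, D z w * a₅ z) / c w) ≤
      4 * K / rm ^ 6 :=
    (mul_le_mul_of_nonneg_left hB (by positivity)).trans (le_of_eq (trunc_cube_decay_eq (4 * K) hrm0))
  have etot : (4 * K + 5 * M₆ + M₂ * M₄) / rm ^ 6 = 4 * K / rm ^ 6 + (5 * M₆ + M₂ * M₄) / rm ^ 6 := by ring
  rw [etot]
  linarith

/-- **THE PAIR–TRIPLE CUT `{1,2}|{3,4,5}`**: with `R = min(r₁₃,r₁₄,r₁₅,r₂₃,r₂₄,r₂₅)⁶` in (544),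
`|E[f₁⋯f₅] − E[f₁f₂]E[f₃f₄f₅]| ≤ (6K + 5M₆ + (M₂+M₄)²∕2 + 3M₂M₄)∕min(⋯)⁶` (arbitrary centring constants). [folklore] -/
theorem pair_triple_cut_bound
    (hP : ∀ x F ω, P x F ω = (∫ s, F (update ω x s) * exp (-V (update ω x s))) / ∫ s, exp (-V (update ω x s)))
    (hV : ∀ x ω, HasDerivAt (fun s => V (update ω x s)) (V₁ x ω) (ω x))
    (hfloor : ∀ x ω s t, c x * (s - t) ^ 2 ≤ (V₁ x (update ω x s) - V₁ x (update ω x t)) * (s - t)) (hc : ∀ x, 0 < c x)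
    (hceil : ∀ x ω s t, |V₁ x (update ω x s) - V₁ x (update ω x t)| ≤ Cw * |s - t|)
    (hcross : ∀ x z, z ≠ x → ∀ ω s t, |V₁ x (update ω z s) - V₁ x (update ω z t)| ≤ J x z * |s - t|) (hVc : Continuous V)
    (hV0 : Integrable (fun ω : ι → ℝ => exp (-V ω))) (hV2 : ∀ z, Integrable (fun ω : ι → ℝ => ω z ^ 2 * exp (-V ω)))
    (hJ : ∀ x z, 0 ≤ J x z) (hJ0 : ∀ x, J x x = 0) (hrow : ∀ x, ∑ z, J x z / c x ≤ γ) (hγ0 : 0 ≤ γ) (hγ1 : γ < 1)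
    (hD : ∀ x y, 0 ≤ D x y) (hDC : ∀ x y, (if x = y then (1 : ℝ) else 0) + ∑ z, D x z * (J z y / c z) ≤ D x y)
    (h1 : ∀ z ω s t, |F₁ (update ω z s) - F₁ (update ω z t)| ≤ a₁ z * |s - t|)
    (h2 : ∀ z ω s t, |F₂ (update ω z s) - F₂ (update ω z t)| ≤ a₂ z * |s - t|)
    (h3 : ∀ z ω s t, |F₃ (update ω z s) - F₃ (update ω z t)| ≤ a₃ z * |s - t|)
    (h4 : ∀ z ω s t, |F₄ (update ω z s) - F₄ (update ω z t)| ≤ a₄ z * |s - t|)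
    (h5 : ∀ z ω s t, |F₅ (update ω z s) - F₅ (update ω z t)| ≤ a₅ z * |s - t|) (m₁ m₂ m₃ m₄ m₅ : ℝ)
    {K r13 r14 r15 r23 r24 r25 M₂ M₄ M₆ : ℝ} (hK : 0 ≤ K) (hr13 : 1 ≤ r13) (hr14 : 1 ≤ r14) (hr15 : 1 ≤ r15) (hr23 : 1 ≤ r23) (hr24 : 1 ≤ r24) (hr25
        : 1 ≤ r25)
    (hB13 : (∑ w, (∑ z, D z w * a₁ z) * (∑ z, D z w * a₃ z) / c w) ≤ K / r13 ^ 24) (hB14 : (∑ w, (∑ z, D z w * a₁ z) * (∑ z, D z w * a₄ z) / c w) ≤ K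
        / r14 ^ 24) (hB15 : (∑ w, (∑ z, D z w * a₁ z) * (∑ z, D z w * a₅ z) / c w) ≤ K / r15 ^ 24) (hB23 : (∑ w, (∑ z, D z w * a₂ z) * (∑ z, D z w *
        a₃ z) / c w) ≤ K / r23 ^ 24) (hB24 : (∑ w, (∑ z, D z w * a₂ z) * (∑ z, D z w * a₄ z) / c w) ≤ K / r24 ^ 24) (hB25 : (∑ w, (∑ z, D z w * a₂ z)
        * (∑ z, D z w * a₅ z) / c w) ≤ K / r25 ^ 24)
    (hq1 : Integrable (fun ω => (F₁ ω - m₁) ^ 4) ((volume : Measure (ι → ℝ)).tilted fun ω => -V ω))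
    (hq2 : Integrable (fun ω => (F₂ ω - m₂) ^ 4) ((volume : Measure (ι → ℝ)).tilted fun ω => -V ω))
    (hq3 : Integrable (fun ω => (F₃ ω - m₃) ^ 4) ((volume : Measure (ι → ℝ)).tilted fun ω => -V ω))
    (hq4 : Integrable (fun ω => (F₄ ω - m₄) ^ 4) ((volume : Measure (ι → ℝ)).tilted fun ω => -V ω))
    (hq5 : Integrable (fun ω => (F₅ ω - m₅) ^ 4) ((volume : Measure (ι → ℝ)).tilted fun ω => -V ω))
    (hs1 : Integrable (fun ω => (F₁ ω - m₁) ^ 6) ((volume : Measure (ι → ℝ)).tilted fun ω => -V ω))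
    (hs2 : Integrable (fun ω => (F₂ ω - m₂) ^ 6) ((volume : Measure (ι → ℝ)).tilted fun ω => -V ω))
    (hs3 : Integrable (fun ω => (F₃ ω - m₃) ^ 6) ((volume : Measure (ι → ℝ)).tilted fun ω => -V ω))
    (hs4 : Integrable (fun ω => (F₄ ω - m₄) ^ 6) ((volume : Measure (ι → ℝ)).tilted fun ω => -V ω))
    (hs5 : Integrable (fun ω => (F₅ ω - m₅) ^ 6) ((volume : Measure (ι → ℝ)).tilted fun ω => -V ω))
    (hM21 : ∫ ω, (F₁ ω - m₁) ^ 2 ∂((volume : Measure (ι → ℝ)).tilted fun ω => -V ω) ≤ M₂)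
    (hM22 : ∫ ω, (F₂ ω - m₂) ^ 2 ∂((volume : Measure (ι → ℝ)).tilted fun ω => -V ω) ≤ M₂)
    (hM23 : ∫ ω, (F₃ ω - m₃) ^ 2 ∂((volume : Measure (ι → ℝ)).tilted fun ω => -V ω) ≤ M₂)
    (hM41 : ∫ ω, (F₁ ω - m₁) ^ 4 ∂((volume : Measure (ι → ℝ)).tilted fun ω => -V ω) ≤ M₄)
    (hM42 : ∫ ω, (F₂ ω - m₂) ^ 4 ∂((volume : Measure (ι → ℝ)).tilted fun ω => -V ω) ≤ M₄)
    (hM43 : ∫ ω, (F₃ ω - m₃) ^ 4 ∂((volume : Measure (ι → ℝ)).tilted fun ω => -V ω) ≤ M₄)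
    (hM44 : ∫ ω, (F₄ ω - m₄) ^ 4 ∂((volume : Measure (ι → ℝ)).tilted fun ω => -V ω) ≤ M₄)
    (hM45 : ∫ ω, (F₅ ω - m₅) ^ 4 ∂((volume : Measure (ι → ℝ)).tilted fun ω => -V ω) ≤ M₄)
    (hM61 : ∫ ω, (F₁ ω - m₁) ^ 6 ∂((volume : Measure (ι → ℝ)).tilted fun ω => -V ω) ≤ M₆)
    (hM62 : ∫ ω, (F₂ ω - m₂) ^ 6 ∂((volume : Measure (ι → ℝ)).tilted fun ω => -V ω) ≤ M₆)
    (hM63 : ∫ ω, (F₃ ω - m₃) ^ 6 ∂((volume : Measure (ι → ℝ)).tilted fun ω => -V ω) ≤ M₆)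
    (hM64 : ∫ ω, (F₄ ω - m₄) ^ 6 ∂((volume : Measure (ι → ℝ)).tilted fun ω => -V ω) ≤ M₆)
    (hM65 : ∫ ω, (F₅ ω - m₅) ^ 6 ∂((volume : Measure (ι → ℝ)).tilted fun ω => -V ω) ≤ M₆) :
    |(∫ ω, (F₁ ω - m₁) * (F₂ ω - m₂) * (F₃ ω - m₃) * (F₄ ω - m₄) * (F₅ ω - m₅) ∂((volume : Measure (ι → ℝ)).tilted fun ω => -V ω)) -
        (∫ ω, (F₁ ω - m₁) * (F₂ ω - m₂) ∂((volume : Measure (ι → ℝ)).tilted fun ω => -V ω)) * (∫ ω, (F₃ ω - m₃) * (F₄ ω - m₄) * (F₅ ω - m₅) ∂((volume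
            : Measure (ι → ℝ)).tilted fun ω => -V ω))| ≤
      (6 * K + 5 * M₆ + (M₂ + M₄) ^ 2 / 2 + 3 * M₂ * M₄) / (min r13 (min r14 (min r15 (min r23 (min r24 r25))))) ^ 6 := by
  set rm : ℝ := min r13 (min r14 (min r15 (min r23 (min r24 r25)))) with hrm
  have hrm1 : 1 ≤ rm := le_min hr13 (le_min hr14 (le_min hr15 (le_min hr23 (le_min hr24 (hr25)))))
  have hrm0 : 0 < rm := by linarith
  have l13 : rm ≤ r13 := min_le_left _ _
  have l14 : rm ≤ r14 := (min_le_right _ _).trans (min_le_left _ _)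
  have l15 : rm ≤ r15 := (min_le_right _ _).trans ((min_le_right _ _).trans (min_le_left _ _))
  have l23 : rm ≤ r23 := (min_le_right _ _).trans ((min_le_right _ _).trans ((min_le_right _ _).trans (min_le_left _ _)))
  have l24 : rm ≤ r24 := (min_le_right _ _).trans ((min_le_right _ _).trans ((min_le_right _ _).trans ((min_le_right _ _).trans (min_le_left _ _))))
  have l25 : rm ≤ r25 := (min_le_right _ _).trans ((min_le_right _ _).trans ((min_le_right _ _).trans ((min_le_right _ _).trans (min_le_right _ _))))
  have hR : 0 < rm ^ 6 := by positivity
  have h := group_cov_two_three_le hP hV hfloor hc hceil hcross hVc hV0 hV2 hJ hJ0 hrow hγ0 hγ1 hD hDC h1 h2 h3 h4 h5 m₁ m₂ m₃ m₄ m₅ hR hq1 hq2 hq3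
      hq4 hq5 hs1 hs2 hs3 hs4 hs5 hM21 hM22 hM23 hM41 hM42 hM43 hM44 hM45 hM61 hM62
    hM63 hM64 hM65
  have hsplit : ∑ w, ((∑ z, D z w * a₁ z) + ∑ z, D z w * a₂ z) * ((∑ z, D z w * a₃ z) + (∑ z, D z w * a₄ z) + ∑ z, D z w * a₅ z) / c w =
      (∑ w, (∑ z, D z w * a₁ z) * (∑ z, D z w * a₃ z) / c w) + (∑ w, (∑ z, D z w * a₁ z) * (∑ z, D z w * a₄ z) / c w) + (∑ w, (∑ z, D z w * a₁ z) *
          (∑ z, D z w * a₅ z) / c w) + (∑ w, (∑ z, D z w * a₂ z) * (∑ z, D z w * a₃ z) / c w) + (∑ w, (∑ z, D z w * a₂ z) * (∑ z, D z w * a₄ z) / c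
          w) + (∑ w, (∑ z, D z w * a₂ z) * (∑ z, D z w * a₅ z) / c w) := by
    rw [← Finset.sum_add_distrib, ← Finset.sum_add_distrib, ← Finset.sum_add_distrib, ← Finset.sum_add_distrib, ← Finset.sum_add_distrib]
    exact Finset.sum_congr rfl fun w _ => by ring
  have hB : ∑ w, ((∑ z, D z w * a₁ z) + ∑ z, D z w * a₂ z) * ((∑ z, D z w * a₃ z) + (∑ z, D z w * a₄ z) + ∑ z, D z w * a₅ z) / c w ≤ 6 * K / rm ^ 24
      := by
    rw [hsplit]
    have e13 := div_le_div_of_nonneg_left hK (by positivity : (0 : ℝ) < rm ^ 24) (pow_le_pow_left₀ hrm0.le l13 24)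
    have e14 := div_le_div_of_nonneg_left hK (by positivity : (0 : ℝ) < rm ^ 24) (pow_le_pow_left₀ hrm0.le l14 24)
    have e15 := div_le_div_of_nonneg_left hK (by positivity : (0 : ℝ) < rm ^ 24) (pow_le_pow_left₀ hrm0.le l15 24)
    have e23 := div_le_div_of_nonneg_left hK (by positivity : (0 : ℝ) < rm ^ 24) (pow_le_pow_left₀ hrm0.le l23 24)
    have e24 := div_le_div_of_nonneg_left hK (by positivity : (0 : ℝ) < rm ^ 24) (pow_le_pow_left₀ hrm0.le l24 24)
    have e25 := div_le_div_of_nonneg_left hK (by positivity : (0 : ℝ) < rm ^ 24) (pow_le_pow_left₀ hrm0.le l25 24)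
    have e6 : 6 * K / rm ^ 24 = K / rm ^ 24 + K / rm ^ 24 + K / rm ^ 24 + K / rm ^ 24 + K / rm ^ 24 + K / rm ^ 24 := by ring
    rw [e6]
    linarith [hB13.trans e13, hB14.trans e14, hB15.trans e15, hB23.trans e23, hB24.trans e24, hB25.trans e25]
  have hT : (rm ^ 6) ^ 3 * (∑ w, ((∑ z, D z w * a₁ z) + ∑ z, D z w * a₂ z) * ((∑ z, D z w * a₃ z) + (∑ z, D z w * a₄ z) + ∑ z, D z w * a₅ z) / c w) ≤
      6 * K / rm ^ 6 :=
    (mul_le_mul_of_nonneg_left hB (by positivity)).trans (le_of_eq (trunc_cube_decay_eq (6 * K) hrm0))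
  have etot : (6 * K + 5 * M₆ + (M₂ + M₄) ^ 2 / 2 + 3 * M₂ * M₄) / rm ^ 6 = 6 * K / rm ^ 6 + (5 * M₆ + (M₂ + M₄) ^ 2 / 2 + 3 * M₂ * M₄) / rm ^ 6 := by
    ring
  rw [etot]
  linarith

/-! ## §3. Toy -/

/-- Toy (§1 in numbers): `(1⁶)³·(4∕1²⁴) = 4∕1⁶`. -/
example : ((1 : ℝ) ^ 6) ^ 3 * (4 / 1 ^ 24) = 4 / 1 ^ 6 := trunc_cube_decay_eq 4 one_pos

end Summit.QuantumFields.BalabanUV.T4Continuum.NE7b.SupFifthCumulantCutBounds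

end
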